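import Summits.MatrixMultiplication.MatrixMultiplication.Theses.DefinableSTPPDichotomy
import Literature.ModelTheory.PseudofiniteFields.DefinableSetsFiniteFieldsDecomposition

/-!
# Skeleton of line `Sketch` (reshaped: vacuity via lonely translates) for the crux
`DefinableSTPPDichotomy.HexagonClearanceR` (stmt-MatrixMultiplication-17884)

Composition (all intermediate statements INLINE — no definitions — so that every stub can be landed
verbatim as a `--supports` file in the kernel lane):

* `stub_massBound_of_shadowBound` : ShadowBoundLC → MassBoundLC            (three packings, 3-term AM–GM)
* `stub_shadowBound_of_noLonely`  : NoLonelyTranslateLC → ShadowBoundLC    (pattern k = i: isolating translates)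
* `stub_noLonely_of_alg`       : NormalFormLC → NoLonelyAlgLC → NoLonelyTranslateLC   (plumbing)
* `stub_normalForm_of_prop27`  : CDM Prop. 2.7 (named fact, tree) → NormalFormLC     (`prop27_finite_of_psf`)
* `stub_radicalNormalForm`     : RadicalNormalFormLC — generic separability of normal forms (algebra).
* `stub_persistence`           : PersistenceLC — no lonely point at a simple root (the algebraic-geometric core).
* `noLonelyAlg`                : NoLonelyAlgLC from 6a + 6b (glue, proved).
* `stub_prop27`                : the named fact itself (CDM 1992 Prop. 2.7), registered as a stub.
* `HexagonClearanceR_of`       : the crux (transfer step MassBoundLC → R written out: ε₀ := 1/(m+1),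
  characteristic threshold chosen after η).
-/

set_option linter.dupNamespace false

namespace Summit.MatrixMultiplication.MatrixMultiplication.Theorems.HexagonClearanceR

open Finset
open Summit.MatrixMultiplication.MatrixMultiplication.Theses.DefinableSTPPDichotomy
open Literature.ModelTheory.PseudofiniteFields

/-- Stub 2: the shadow bound on the big-`A` blocks gives the mass bound (three packings from the
2-label patterns, block TPP, three-term AM–GM with weight `q^{-1/3}`). -/
theorem stub_massBound_of_shadowBound
    (hS : (∀ (e m k : ℕ) (φI : FirstOrder.Language.ring.Formula (Fin e ⊕ Fin k))
        (φA φB φC : FirstOrder.Language.ring.Formula ((Fin e ⊕ Fin m) ⊕ Fin k)),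
        ∃ (C₀ q₁ : ℕ), ∀ (F : Type) [Field F] [Fintype F] [FirstOrder.Ring.CompatibleRing F],
        q₁ ≤ ringChar F → ∀ (y : Fin k → F) (I : Finset (Fin e → F))
          (A B C : (Fin e → F) → Finset (Fin m → F)),
          (∀ x, x ∈ I ↔ φI.Realize (Sum.elim x y)) →
          (∀ x v, v ∈ A x ↔ φA.Realize (Sum.elim (Sum.elim x v) y)) →
          (∀ x v, v ∈ B x ↔ φB.Realize (Sum.elim (Sum.elim x v) y)) →
          (∀ x v, v ∈ C x ↔ φC.Realize (Sum.elim (Sum.elim x v) y)) →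
          (∀ i ∈ I, ∀ j ∈ I, ∀ k ∈ I, (i = j ∨ j = k ∨ k = i) → ∀ s ∈ A k, ∀ s' ∈ A i,
            ∀ t ∈ B i, ∀ t' ∈ B j, ∀ u ∈ C j, ∀ u' ∈ C k,
            (s' - s) + (t' - t) + (u' - u) = 0 → i = j ∧ j = k ∧ s = s' ∧ t = t' ∧ u = u') →
          ∑ x ∈ I.filter (fun x => C₀ < (A x).card), ((B x).card : ℝ) * (C x).card
            ≤ C₀ * (Fintype.card F : ℝ) ^ ((m : ℝ) - 1))) :
    (∀ (e m k : ℕ) (φI : FirstOrder.Language.ring.Formula (Fin e ⊕ Fin k))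
        (φA φB φC : FirstOrder.Language.ring.Formula ((Fin e ⊕ Fin m) ⊕ Fin k)),
        ∃ (K : ℝ) (q₁ : ℕ), ∀ (F : Type) [Field F] [Fintype F] [FirstOrder.Ring.CompatibleRing F],
        q₁ ≤ ringChar F → ∀ (y : Fin k → F) (I : Finset (Fin e → F))
          (A B C : (Fin e → F) → Finset (Fin m → F)),
          (∀ x, x ∈ I ↔ φI.Realize (Sum.elim x y)) →
          (∀ x v, v ∈ A x ↔ φA.Realize (Sum.elim (Sum.elim x v) y)) →
          (∀ x v, v ∈ B x ↔ φB.Realize (Sum.elim (Sum.elim x v) y)) →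
          (∀ x v, v ∈ C x ↔ φC.Realize (Sum.elim (Sum.elim x v) y)) →
          (∀ i ∈ I, ∀ j ∈ I, ∀ k ∈ I, (i = j ∨ j = k ∨ k = i) → ∀ s ∈ A k, ∀ s' ∈ A i,
            ∀ t ∈ B i, ∀ t' ∈ B j, ∀ u ∈ C j, ∀ u' ∈ C k,
            (s' - s) + (t' - t) + (u' - u) = 0 → i = j ∧ j = k ∧ s = s' ∧ t = t' ∧ u = u') →
          ∀ ε : ℝ, 0 < ε → ε ≤ 1 / ((m : ℝ) + 1) →
            ∑ x ∈ I, (((A x).card * (B x).card * (C x).card : ℕ) : ℝ) ^ ((2 + ε) / 3)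
              ≤ K * (Fintype.card F : ℝ) ^ (m : ℝ)) := by
  sorry

/-- Stub 3: recurrence of definable translates (no lonely generic point) gives the shadow bound, by the
isolating-translates consequence of pattern `k = i` applied to the `B − C` shadow and a big block `A_x`. -/
theorem stub_shadowBound_of_noLonely
    (hN : (∀ (m n n' : ℕ) (τ : FirstOrder.Language.ring.Formula (Fin m ⊕ Fin n))
        (α : FirstOrder.Language.ring.Formula (Fin m ⊕ Fin n')),
        ∃ (K Q : ℕ) (C₀ : ℝ), ∀ (F : Type) [Field F] [Fintype F] [FirstOrder.Ring.CompatibleRing F],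
        Q ≤ ringChar F → ∀ (y : Fin n → F), ∃ E : Finset (Fin m → F),
          (E.card : ℝ) ≤ C₀ * (Fintype.card F : ℝ) ^ ((m : ℝ) - 1) ∧
          ∀ (y' : Fin n' → F) (T A : Finset (Fin m → F)),
            (∀ w, w ∈ T ↔ τ.Realize (Sum.elim w y)) →
            (∀ v, v ∈ A ↔ α.Realize (Sum.elim v y')) →
            K < A.card → ∀ t ∈ T, t ∉ E → ∃ a₀ ∈ A, ∃ a ∈ A, a ≠ a₀ ∧ t + a - a₀ ∈ T)) :
    (∀ (e m k : ℕ) (φI : FirstOrder.Language.ring.Formula (Fin e ⊕ Fin k))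
        (φA φB φC : FirstOrder.Language.ring.Formula ((Fin e ⊕ Fin m) ⊕ Fin k)),
        ∃ (C₀ q₁ : ℕ), ∀ (F : Type) [Field F] [Fintype F] [FirstOrder.Ring.CompatibleRing F],
        q₁ ≤ ringChar F → ∀ (y : Fin k → F) (I : Finset (Fin e → F))
          (A B C : (Fin e → F) → Finset (Fin m → F)),
          (∀ x, x ∈ I ↔ φI.Realize (Sum.elim x y)) →
          (∀ x v, v ∈ A x ↔ φA.Realize (Sum.elim (Sum.elim x v) y)) →
          (∀ x v, v ∈ B x ↔ φB.Realize (Sum.elim (Sum.elim x v) y)) →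
          (∀ x v, v ∈ C x ↔ φC.Realize (Sum.elim (Sum.elim x v) y)) →
          (∀ i ∈ I, ∀ j ∈ I, ∀ k ∈ I, (i = j ∨ j = k ∨ k = i) → ∀ s ∈ A k, ∀ s' ∈ A i,
            ∀ t ∈ B i, ∀ t' ∈ B j, ∀ u ∈ C j, ∀ u' ∈ C k,
            (s' - s) + (t' - t) + (u' - u) = 0 → i = j ∧ j = k ∧ s = s' ∧ t = t' ∧ u = u') →
          ∑ x ∈ I.filter (fun x => C₀ < (A x).card), ((B x).card : ℝ) * (C x).card
            ≤ C₀ * (Fintype.card F : ℝ) ^ ((m : ℝ) - 1)) := by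
  sorry

/-- Stub 4 (plumbing): the formula version of "no lonely generic point" from the normal form of
definable sets and the algebraic version for normal-form sets. -/
theorem stub_noLonely_of_alg
    (hNF : (∀ (m n : ℕ) (φ : FirstOrder.Language.ring.Formula (Fin m ⊕ Fin n)),
        ∃ (L D Q : ℕ), ∀ (F : Type) [Field F] [Fintype F] [FirstOrder.Ring.CompatibleRing F],
        Q ≤ Fintype.card F → ∀ (y : Fin n → F), ∃ G : Fin L → MvPolynomial (Fin (m + 1)) F,
          (∀ l, (G l).totalDegree ≤ D) ∧
          ∀ w : Fin m → F, (φ.Realize (Sum.elim w y) ↔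
            ∀ l, ∃ t : F, MvPolynomial.eval (Fin.snoc w t : Fin (m + 1) → F) (G l) = 0)))
    (hA : (∀ (m L L' D : ℕ), ∃ (K Q : ℕ) (C₀ : ℝ), ∀ (F : Type) [Field F] [Fintype F],
        Q ≤ ringChar F → ∀ (G : Fin L → MvPolynomial (Fin (m + 1)) F),
          (∀ l, (G l).totalDegree ≤ D) → ∃ E : Finset (Fin m → F),
          (E.card : ℝ) ≤ C₀ * (Fintype.card F : ℝ) ^ ((m : ℝ) - 1) ∧
          ∀ (H : Fin L' → MvPolynomial (Fin (m + 1)) F), (∀ l, (H l).totalDegree ≤ D) →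
          ∀ (T A : Finset (Fin m → F)),
            (∀ w, w ∈ T ↔ ∀ l, ∃ t : F, MvPolynomial.eval (Fin.snoc w t : Fin (m + 1) → F) (G l) = 0) →
            (∀ v, v ∈ A ↔ ∀ l, ∃ t : F, MvPolynomial.eval (Fin.snoc v t : Fin (m + 1) → F) (H l) = 0) →
            K < A.card → ∀ t₀ ∈ T, t₀ ∉ E → ∃ a₀ ∈ A, ∃ a ∈ A, a ≠ a₀ ∧ t₀ + a - a₀ ∈ T)) :
    (∀ (m n n' : ℕ) (τ : FirstOrder.Language.ring.Formula (Fin m ⊕ Fin n))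
        (α : FirstOrder.Language.ring.Formula (Fin m ⊕ Fin n')),
        ∃ (K Q : ℕ) (C₀ : ℝ), ∀ (F : Type) [Field F] [Fintype F] [FirstOrder.Ring.CompatibleRing F],
        Q ≤ ringChar F → ∀ (y : Fin n → F), ∃ E : Finset (Fin m → F),
          (E.card : ℝ) ≤ C₀ * (Fintype.card F : ℝ) ^ ((m : ℝ) - 1) ∧
          ∀ (y' : Fin n' → F) (T A : Finset (Fin m → F)),
            (∀ w, w ∈ T ↔ τ.Realize (Sum.elim w y)) →
            (∀ v, v ∈ A ↔ α.Realize (Sum.elim v y')) →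
            K < A.card → ∀ t ∈ T, t ∉ E → ∃ a₀ ∈ A, ∃ a ∈ A, a ≠ a₀ ∧ t + a - a₀ ∈ T) := by
  sorry

/-- Stub 5: the normal form `φ(w; y) ↔ ⋀_l ∃t G_l(w, t) = 0` (polynomials over `F` of bounded degree,
coefficients depending on the parameters and an enrichment) in all large finite fields, from CDM 1992
Prop. (2.7) (tree named fact) via the tree's `prop27_finite_of_psf`. -/
theorem stub_normalForm_of_prop27
    (h27 : ChatzidakisVanDenDriesMacintyre1992_prop27) :
    (∀ (m n : ℕ) (φ : FirstOrder.Language.ring.Formula (Fin m ⊕ Fin n)),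
        ∃ (L D Q : ℕ), ∀ (F : Type) [Field F] [Fintype F] [FirstOrder.Ring.CompatibleRing F],
        Q ≤ Fintype.card F → ∀ (y : Fin n → F), ∃ G : Fin L → MvPolynomial (Fin (m + 1)) F,
          (∀ l, (G l).totalDegree ≤ D) ∧
          ∀ w : Fin m → F, (φ.Realize (Sum.elim w y) ↔
            ∀ l, ∃ t : F, MvPolynomial.eval (Fin.snoc w t : Fin (m + 1) → F) (G l) = 0)) := by
  sorry

/-- Stub 6a (algebraic core, part 1 — lead): RADICAL NORMAL FORM / GENERIC SEPARABILITY.  In large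
characteristic the polynomials `G_l` of a normal form may be replaced (without changing the set
`{w : ∃t G_l(w,t)=0}`) by polynomials `S_l` all of whose `F`-rational roots `t ↦ S_l(w,t)` are SIMPLE
for `w` outside an exceptional set of `O(|F|^{m-1})` points (radical in `F[w][t]`, separability over
`F(w)` since `char F >` degree, resultant with the `t`-derivative, Schwartz–Zippel).  Typing: one-variable
polynomials over `F[X_0, …, X_{m-1}]`, specialised at `w` by `Polynomial.map (MvPolynomial.eval w)`. -/
theorem stub_radicalNormalForm :
    (∀ (m L D : ℕ), ∃ (D' Q : ℕ) (C₀ : ℝ), ∀ (F : Type) [Field F] [Fintype F],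
        Q ≤ ringChar F → ∀ (G : Fin L → Polynomial (MvPolynomial (Fin m) F)),
          (∀ l, (G l).natDegree ≤ D ∧ ∀ k, ((G l).coeff k).totalDegree ≤ D) →
          ∃ S : Fin L → Polynomial (MvPolynomial (Fin m) F),
          (∀ l, (S l).natDegree ≤ D' ∧ ∀ k, ((S l).coeff k).totalDegree ≤ D') ∧
          (∀ l (w : Fin m → F),
            (∃ t : F, Polynomial.eval t (Polynomial.map (MvPolynomial.eval w) (G l)) = 0) ↔
            (∃ t : F, Polynomial.eval t (Polynomial.map (MvPolynomial.eval w) (S l)) = 0)) ∧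
          ∃ E : Finset (Fin m → F), (E.card : ℝ) ≤ C₀ * (Fintype.card F : ℝ) ^ ((m : ℝ) - 1) ∧
            ∀ w : Fin m → F, w ∉ E → ∀ l (t : F),
              Polynomial.eval t (Polynomial.map (MvPolynomial.eval w) (S l)) = 0 →
              Polynomial.eval t (Polynomial.derivative (Polynomial.map (MvPolynomial.eval w) (S l))) ≠ 0) := by
  sorry

/-- Stub 6b (algebraic core, part 2): PERSISTENCE AT A SIMPLE ROOT (no lonely étale-generic point).  If
every `G_l(t₀, ·)` has a simple `F`-rational root, then for every large normal-form set `A` some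
translate `t₀ − a₀ + A`, `a₀ ∈ A`, meets `T = {w : ⋀_l ∃t G_l(w,t)=0}` in a second point (étale
persistence of simple roots along a geometrically irreducible `F`-curve inside the lifted `A` through a
smooth point; Lang–Weil / Hasse–Weil for that curve; large characteristic). -/
theorem stub_persistence :
    (∀ (m L L' D : ℕ), ∃ (K Q : ℕ), ∀ (F : Type) [Field F] [Fintype F],
        Q ≤ ringChar F → ∀ (G : Fin L → Polynomial (MvPolynomial (Fin m) F)),
          (∀ l, (G l).natDegree ≤ D ∧ ∀ k, ((G l).coeff k).totalDegree ≤ D) →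
          ∀ (H : Fin L' → Polynomial (MvPolynomial (Fin m) F)),
          (∀ l, (H l).natDegree ≤ D ∧ ∀ k, ((H l).coeff k).totalDegree ≤ D) →
          ∀ (T A : Finset (Fin m → F)),
            (∀ w, w ∈ T ↔ ∀ l, ∃ t : F, Polynomial.eval t (Polynomial.map (MvPolynomial.eval w) (G l)) = 0) →
            (∀ v, v ∈ A ↔ ∀ l, ∃ t : F, Polynomial.eval t (Polynomial.map (MvPolynomial.eval v) (H l)) = 0) →
            K < A.card → ∀ t₀ ∈ T,
              (∀ l, ∃ t : F, Polynomial.eval t (Polynomial.map (MvPolynomial.eval t₀) (G l)) = 0 ∧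
                Polynomial.eval t (Polynomial.derivative (Polynomial.map (MvPolynomial.eval t₀) (G l))) ≠ 0) →
              ∃ a₀ ∈ A, ∃ a ∈ A, a ≠ a₀ ∧ t₀ + a - a₀ ∈ T) := by
  sorry

/-- Dictionary (last variable as the polynomial variable): `(t, w) ∘ finRotate = (w, t)`. -/
theorem Glue.cons_comp_finRotate {α : Type*} (m : ℕ) (w : Fin m → α) (t : α) :
    (Fin.cons t w : Fin (m + 1) → α) ∘ (finRotate (m + 1)) = Fin.snoc w t := by
  funext i
  simp only [Function.comp_apply]
  refine Fin.lastCases ?_ (fun j => ?_) i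
  · simp
  · rw [Fin.snoc_castSucc]
    have : (finRotate (m + 1)) (Fin.castSucc j) = j.succ := by simp
    rw [this, Fin.cons_succ]

/-- Dictionary: evaluating `p ∈ F[X_0, …, X_m]` at `(w, t)` is evaluating at `t` the specialisation at
`w` of the one-variable polynomial `toPoly p := finSuccEquiv (rename finRotate p)` over `F[X_0, …, X_{m-1}]`. -/
theorem Glue.eval_snoc_eq {F : Type*} [CommRing F] (m : ℕ) (p : MvPolynomial (Fin (m + 1)) F)
    (w : Fin m → F) (t : F) :
    MvPolynomial.eval (Fin.snoc w t : Fin (m + 1) → F) p =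
      Polynomial.eval t (Polynomial.map (MvPolynomial.eval w)
        (MvPolynomial.finSuccEquiv F m (MvPolynomial.rename (finRotate (m + 1)) p))) := by
  rw [← MvPolynomial.eval_eq_eval_mv_eval', MvPolynomial.eval_rename, Glue.cons_comp_finRotate]

/-- Dictionary: the `t`-degree of `toPoly p` is at most the total degree of `p`. -/
theorem Glue.natDegree_toPoly_le {F : Type*} [CommRing F] (m : ℕ) (p : MvPolynomial (Fin (m + 1)) F) :
    (MvPolynomial.finSuccEquiv F m (MvPolynomial.rename (finRotate (m + 1)) p)).natDegree ≤
      p.totalDegree := by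
  rw [MvPolynomial.natDegree_finSuccEquiv]
  exact (MvPolynomial.degreeOf_le_totalDegree _ _).trans (MvPolynomial.totalDegree_rename_le _ _)

/-- Dictionary: the coefficients of `toPoly p` have total degree at most that of `p`. -/
theorem Glue.totalDegree_coeff_toPoly_le {F : Type*} [CommRing F] (m : ℕ)
    (p : MvPolynomial (Fin (m + 1)) F) (k : ℕ) :
    ((MvPolynomial.finSuccEquiv F m (MvPolynomial.rename (finRotate (m + 1)) p)).coeff k).totalDegree ≤
      p.totalDegree := by
  by_cases h : (MvPolynomial.finSuccEquiv F m (MvPolynomial.rename (finRotate (m + 1)) p)).coeff k = 0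
  · rw [h, MvPolynomial.totalDegree_zero]; exact Nat.zero_le _
  · exact le_trans (Nat.le_add_right _ _) ((MvPolynomial.totalDegree_coeff_finSuccEquiv_add_le _ k h).trans
      (MvPolynomial.totalDegree_rename_le _ _))

/-- The algebraic "no lonely generic point" (in the `F[X_0..X_m]` / `Fin.snoc` typing of stub 4) from
stubs 6a and 6b (in the one-variable typing): pass to `toPoly`, replace `G` by its radical normal form
`S`; outside the exceptional set every rational root is simple, so persistence applies. -/
theorem noLonelyAlg :
    (∀ (m L L' D : ℕ), ∃ (K Q : ℕ) (C₀ : ℝ), ∀ (F : Type) [Field F] [Fintype F],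
        Q ≤ ringChar F → ∀ (G : Fin L → MvPolynomial (Fin (m + 1)) F),
          (∀ l, (G l).totalDegree ≤ D) → ∃ E : Finset (Fin m → F),
          (E.card : ℝ) ≤ C₀ * (Fintype.card F : ℝ) ^ ((m : ℝ) - 1) ∧
          ∀ (H : Fin L' → MvPolynomial (Fin (m + 1)) F), (∀ l, (H l).totalDegree ≤ D) →
          ∀ (T A : Finset (Fin m → F)),
            (∀ w, w ∈ T ↔ ∀ l, ∃ t : F, MvPolynomial.eval (Fin.snoc w t : Fin (m + 1) → F) (G l) = 0) →
            (∀ v, v ∈ A ↔ ∀ l, ∃ t : F, MvPolynomial.eval (Fin.snoc v t : Fin (m + 1) → F) (H l) = 0) →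
            K < A.card → ∀ t₀ ∈ T, t₀ ∉ E → ∃ a₀ ∈ A, ∃ a ∈ A, a ≠ a₀ ∧ t₀ + a - a₀ ∈ T) := by
  intro m L L' D
  obtain ⟨D', Q₁, C₀, hR⟩ := stub_radicalNormalForm m L D
  obtain ⟨K, Q₂, hP⟩ := stub_persistence m L L' (max D D')
  refine ⟨K, max Q₁ Q₂, C₀, ?_⟩
  intro F _ _ hQ G hG
  -- one-variable forms of the `G l`
  set G' : Fin L → Polynomial (MvPolynomial (Fin m) F) := fun l =>
    MvPolynomial.finSuccEquiv F m (MvPolynomial.rename (finRotate (m + 1)) (G l)) with hG'def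
  have hG' : ∀ l, (G' l).natDegree ≤ D ∧ ∀ k, ((G' l).coeff k).totalDegree ≤ D := fun l =>
    ⟨(Glue.natDegree_toPoly_le m (G l)).trans (hG l),
      fun k => (Glue.totalDegree_coeff_toPoly_le m (G l) k).trans (hG l)⟩
  obtain ⟨S, hSdeg, hSiff, E, hE, hsimple⟩ := hR F (le_trans (le_max_left _ _) hQ) G' hG'
  refine ⟨E, hE, ?_⟩
  intro H hH T A hT hA hK t₀ ht₀ ht₀E
  set H' : Fin L' → Polynomial (MvPolynomial (Fin m) F) := fun l =>
    MvPolynomial.finSuccEquiv F m (MvPolynomial.rename (finRotate (m + 1)) (H l)) with hH'def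
  have hH' : ∀ l, (H' l).natDegree ≤ max D D' ∧ ∀ k, ((H' l).coeff k).totalDegree ≤ max D D' := fun l =>
    ⟨((Glue.natDegree_toPoly_le m (H l)).trans (hH l)).trans (le_max_left _ _),
      fun k => ((Glue.totalDegree_coeff_toPoly_le m (H l) k).trans (hH l)).trans (le_max_left _ _)⟩
  have hT' : ∀ w, w ∈ T ↔ ∀ l, ∃ t : F,
      Polynomial.eval t (Polynomial.map (MvPolynomial.eval w) (S l)) = 0 := by
    intro w
    rw [hT w]
    refine forall_congr' fun l => Iff.trans ?_ (hSiff l w)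
    simp only [hG'def, Glue.eval_snoc_eq]
  have hA' : ∀ v, v ∈ A ↔ ∀ l, ∃ t : F,
      Polynomial.eval t (Polynomial.map (MvPolynomial.eval v) (H' l)) = 0 := by
    intro v
    rw [hA v]
    simp only [hH'def, Glue.eval_snoc_eq]
  have hSdeg' : ∀ l, (S l).natDegree ≤ max D D' ∧ ∀ k, ((S l).coeff k).totalDegree ≤ max D D' :=
    fun l => ⟨(hSdeg l).1.trans (le_max_right _ _), fun k => ((hSdeg l).2 k).trans (le_max_right _ _)⟩
  refine hP F (le_trans (le_max_right _ _) hQ) S hSdeg' H' hH' T A hT' hA' hK t₀ ht₀ fun l => ?_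
  obtain ⟨t, ht⟩ := (hT' t₀).1 ht₀ l
  exact ⟨t, ht, hsimple t₀ ht₀E l t ht⟩

/-- Stub 7 (named fact as a stub): Chatzidakis–van den Dries–Macintyre 1992, Prop. (2.7), principal
clause — the tree's named fact `Literature.ModelTheory.PseudofiniteFields.ChatzidakisVanDenDriesMacintyre1992_prop27`
(hypothesis of the tree's CDM Main Theorem; Ax 1968 / van den Dries normal form).  Registered as a stub so
that the composition below has no free hypothesis; it is discharged only by a proof of the named fact. -/
theorem stub_prop27 : ChatzidakisVanDenDriesMacintyre1992_prop27 := by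
  sorry

/-- The characteristic of a finite field is at most its cardinality. -/
theorem ringChar_le_card (F : Type*) [Field F] [Fintype F] : ringChar F ≤ Fintype.card F := by
  obtain ⟨n, _, hcard⟩ := FiniteField.card F (ringChar F)
  rw [hcard]
  exact Nat.le_self_pow n.ne_zero _

/-- **The crux from the stubs** (transfer step written out): the uniform mass bound
`Σ_I (abc)^{(2+ε)/3} ≤ K·|F|^m` (`ε ≤ 1/(m+1)`, characteristic `≥ q₁`) supplied by the stubs makes
`HexagonClearanceR` vacuously true: take `ε₀ := 1/(m+1)` and, given `η > 0`, a characteristic threshold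
`≥ (max K 1 + 1)^{1/η}`; then `|F|^{m+η} ≤ mass ≤ K |F|^m < |F|^{m+η}` is absurd. -/
theorem HexagonClearanceR_of : HexagonClearanceR := by
  have hM : (∀ (e m k : ℕ) (φI : FirstOrder.Language.ring.Formula (Fin e ⊕ Fin k))
        (φA φB φC : FirstOrder.Language.ring.Formula ((Fin e ⊕ Fin m) ⊕ Fin k)),
        ∃ (K : ℝ) (q₁ : ℕ), ∀ (F : Type) [Field F] [Fintype F] [FirstOrder.Ring.CompatibleRing F],
        q₁ ≤ ringChar F → ∀ (y : Fin k → F) (I : Finset (Fin e → F))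
          (A B C : (Fin e → F) → Finset (Fin m → F)),
          (∀ x, x ∈ I ↔ φI.Realize (Sum.elim x y)) →
          (∀ x v, v ∈ A x ↔ φA.Realize (Sum.elim (Sum.elim x v) y)) →
          (∀ x v, v ∈ B x ↔ φB.Realize (Sum.elim (Sum.elim x v) y)) →
          (∀ x v, v ∈ C x ↔ φC.Realize (Sum.elim (Sum.elim x v) y)) →
          (∀ i ∈ I, ∀ j ∈ I, ∀ k ∈ I, (i = j ∨ j = k ∨ k = i) → ∀ s ∈ A k, ∀ s' ∈ A i,
            ∀ t ∈ B i, ∀ t' ∈ B j, ∀ u ∈ C j, ∀ u' ∈ C k,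
            (s' - s) + (t' - t) + (u' - u) = 0 → i = j ∧ j = k ∧ s = s' ∧ t = t' ∧ u = u') →
          ∀ ε : ℝ, 0 < ε → ε ≤ 1 / ((m : ℝ) + 1) →
            ∑ x ∈ I, (((A x).card * (B x).card * (C x).card : ℕ) : ℝ) ^ ((2 + ε) / 3)
              ≤ K * (Fintype.card F : ℝ) ^ (m : ℝ)) :=
    stub_massBound_of_shadowBound (stub_shadowBound_of_noLonely
      (stub_noLonely_of_alg (stub_normalForm_of_prop27 stub_prop27) noLonelyAlg))
  intro e m k φI φA φB φC
  obtain ⟨K, q₁, hK⟩ := hM e m k φI φA φB φC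
  have hm0 : (0 : ℝ) ≤ m := Nat.cast_nonneg m
  refine ⟨1 / ((m : ℝ) + 1), by positivity, ?_⟩
  intro ε η hε hεle hη
  set K' : ℝ := max K 1 with hK'def
  have hK'1 : (1 : ℝ) ≤ K' := le_max_right _ _
  have hK'0 : (0 : ℝ) < K' := lt_of_lt_of_le one_pos hK'1
  set N : ℕ := Nat.ceil ((K' + 1) ^ (1 / η)) with hNdef
  refine ⟨max q₁ (max N 2), ?_⟩
  intro F instF instFin instCR hchar y I A B C hI hA hB hC hpair hmass
  exfalso
  have hcardF : max q₁ (max N 2) ≤ Fintype.card F := hchar.trans (ringChar_le_card F)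
  set q : ℝ := (Fintype.card F : ℝ) with hqdef
  have hq2 : (2 : ℝ) ≤ q := by
    rw [hqdef]; exact_mod_cast le_trans (le_max_right _ _) (le_trans (le_max_right _ _) hcardF)
  have hq0 : (0 : ℝ) < q := by linarith
  have hKq : K' < q ^ η := by
    have h1 : (K' + 1) ^ (1 / η) ≤ q := by
      have : (N : ℝ) ≤ q := by
        rw [hqdef]; exact_mod_cast le_trans (le_max_left _ _) (le_trans (le_max_right _ _) hcardF)
      exact le_trans (Nat.le_ceil _) this
    have h2 : K' + 1 ≤ q ^ η := by
      calc K' + 1 = ((K' + 1) ^ (1 / η)) ^ η := by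
            rw [← Real.rpow_mul (by positivity), one_div, inv_mul_cancel₀ hη.ne', Real.rpow_one]
        _ ≤ q ^ η := Real.rpow_le_rpow (by positivity) h1 hη.le
    linarith
  have hmassle := hK F (le_trans (le_max_left _ _) hchar) y I A B C hI hA hB hC hpair ε hε hεle
  have hlt : K * q ^ (m : ℝ) < q ^ ((m : ℝ) + η) := by
    calc K * q ^ (m : ℝ) ≤ K' * q ^ (m : ℝ) :=
          mul_le_mul_of_nonneg_right (le_max_left _ _) (Real.rpow_nonneg hq0.le _)
      _ < q ^ η * q ^ (m : ℝ) := mul_lt_mul_of_pos_right hKq (Real.rpow_pos_of_pos hq0 _)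
      _ = q ^ ((m : ℝ) + η) := by rw [Real.rpow_add hq0, mul_comm]
  exact absurd (hmass.trans hmassle) (not_le.2 hlt)

end Summit.MatrixMultiplication.MatrixMultiplication.Theorems.HexagonClearanceR
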